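import Summits.QuantumFields.YangMills.Theorems.IR.Negative.OnsetUcSCHomFalseOfMonopoleWire
import Summits.QuantumFields.YangMills.Theorems.ConvexGribovBodyNonSimplyConnectedLatticeGapStubUniversalCoverAux1
import Literature.RepresentationTheory.CompactGroups.CompactSemisimpleUniversalCoverProofs

/-!
# Crux `IR` (stmt-QuantumFields-19354), slot `af-pincer-Uc`, cut d9d9d710e4ae01bd — companion of
# `OnsetUcSCHomFalseOfMonopoleWire`: the admissible cover DISCHARGED, and the unconditional headline
# `MonopoleWire → ¬ OnsetMixingTypicalUKPcSCHom` (disprove-1 g7, Negative lane)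

`AdmissibleCover` (every admissible non-simply-connected `G` is covered by an admissible simply connected `H` through a
continuous surjective non-injective homomorphism) is a THEOREM of the tree: Weyl's covering theorem
`Literature.RepresentationTheory.CompactGroups.CompactSemisimpleUniversalCover_holds` (Bröcker–tom Dieck V (7.1),
Remark (7.13), III (4.1); Sepanski Thm. 1.22, Cor. 6.33) fed into crux 16405's landed topological-group reduction
`NonSimplyConnectedLatticeGap.stub_universalCover_of_cover` (`ker π ≠ ⊥` ⇒ `π` not injective).  That reduction imports
the `ConvexGribovBody` route file, so this discharge is isolated here (theses-cone hygiene); the main module stays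
cone-free.  Sorry-free; axioms `propext`, `Classical.choice`, `Quot.sound`.
-/

set_option autoImplicit false

noncomputable section

namespace Summit.QuantumFields.YangMills.Cruxes.IR.OnsetFormatsUc

/-- **`AdmissibleCover` holds** (Weyl's covering theorem, tree-proved, in the shape of crux 16405's stub COVER). -/
theorem admissibleCover_holds : AdmissibleCover := by
  intro G _ _ _ _ hG hnsc
  obtain ⟨H, _, _, _, _, _, _, π, hH, hsc, hπ, hπs, -, -, hker⟩ :=
    Theorems.NonSimplyConnectedLatticeGap.stub_universalCover_of_cover
      Literature.RepresentationTheory.CompactGroups.CompactSemisimpleUniversalCover_holds G hG hnsc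
  exact ⟨H, inferInstance, inferInstance, inferInstance, inferInstance, π, hH, hsc, hπ, hπs,
    fun hinj => hker ((MonoidHom.ker_eq_bot_iff π).2 hinj)⟩

/-- **`MonopoleWire → CentreBlindWireSC`, unconditionally.** -/
theorem centreBlindWireSC_of_monopoleWire' (h : MonopoleWire) : CentreBlindWireSC :=
  centreBlindWireSC_of_monopoleWire admissibleCover_holds h

/-- **`MonopoleWire → ¬ OnsetMixingTypicalUKPcSCBlind`, unconditionally.** -/
theorem not_onsetMixingTypicalUKPcSCBlind_of_monopoleWire' (h : MonopoleWire) : ¬ OnsetMixingTypicalUKPcSCBlind :=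
  not_onsetMixingTypicalUKPcSCBlind_of_monopoleWire admissibleCover_holds h

/-- **HEADLINE, unconditionally: `MonopoleWire → ¬ OnsetMixingTypicalUKPcSCHom`** — the lead stub's repaired
statement C′ = `OnsetMixingTypicalUKPcSC` WITHOUT `LatticeRep.injective` is false as soon as one admissible
non-simply-connected group carries the forced-monopole wire: faithfulness is load-bearing in `stub_onsetUcSC`. -/
theorem not_onsetMixingTypicalUKPcSCHom_of_monopoleWire' (h : MonopoleWire) : ¬ OnsetMixingTypicalUKPcSCHom :=
  not_onsetMixingTypicalUKPcSCHom_of_monopoleWire admissibleCover_holds h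

end Summit.QuantumFields.YangMills.Cruxes.IR.OnsetFormatsUc

end
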